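import Mathlib

/-!
# An ultra-Liouville number for crux `KhovanskiiApproxType` (stmt-Schanuel-6116), negative lane

Sibling of `Negative/LoadBearing.lean`. The TOWER `t 0 = 1`, `t (k+1) = 10^((k+1)^2 · t k)` and the real
number `r = ∑ⱼ 10^(−t j)`: its partial sums `rpart k = pnum k / 10^(t k)` approximate it to within
`2·10^(−t (k+1))` (`tail_le`), hyper-fast relative to the denominator `q_k = 10^(t k)` (indeed relative to
any fixed power of `q_k^k`, which is what the stage lemma of `Negative/WithoutKhovanskii.lean` consumes);
in particular `r` is Liouville, hence irrational (`liouville_r`, `irrational_r`), so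
`s = (log 2, r·log 2)` is `ℚ`-linearly independent. Used to show that the Khovanskii-system hypothesis of
the crux is load-bearing (`khovanskiiApproxType_false_without_khovanskii`). Mathlib only. [folklore]
-/

noncomputable section

set_option linter.dupNamespace false

namespace Summit.Schanuel.Schanuel.Cruxes.KhovanskiiApproxType.Negative.Tower


/-- The tower `t 0 = 1`, `t (k+1) = 10 ^ ((k+1)^2 · t k)`. -/
def t : ℕ → ℕ
  | 0 => 1
  | k + 1 => 10 ^ ((k + 1) ^ 2 * t k)

/-- `t 0 = 1`. -/
theorem t_zero : t 0 = 1 := rfl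

/-- `t (k+1) = 10^((k+1)^2 · t k)`. -/
theorem t_succ (k : ℕ) : t (k + 1) = 10 ^ ((k + 1) ^ 2 * t k) := rfl

/-- `1 ≤ t k`. -/
theorem one_le_t (k : ℕ) : 1 ≤ t k := by
  cases k with
  | zero => simp [t]
  | succ k => rw [t_succ]; exact Nat.one_le_pow _ _ (by norm_num)

/-- `(k+1)^2 · t k < t (k+1)` (since `m < 10^m`). -/
theorem lt_t_succ (k : ℕ) : (k + 1) ^ 2 * t k < t (k + 1) := by
  rw [t_succ]; exact Nat.lt_pow_self (by norm_num)

/-- `t` is strictly increasing at each step. -/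
theorem t_lt_t_succ (k : ℕ) : t k < t (k + 1) :=
  lt_of_le_of_lt (Nat.le_mul_of_pos_left _ (by positivity)) (lt_t_succ k)

/-- `t` is strictly monotone. -/
theorem t_strictMono : StrictMono t := strictMono_nat_of_lt_succ t_lt_t_succ

/-- `t` is monotone. -/
theorem t_mono : Monotone t := t_strictMono.monotone

/-- `k + 1 ≤ t k`. -/
theorem succ_le_t (k : ℕ) : k + 1 ≤ t k := by
  induction k with
  | zero => simp [t]
  | succ k ih => have := t_lt_t_succ k; omega

/-- `t k + j ≤ t (k + j)`: the tower grows at least linearly. -/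
theorem t_add_le (k j : ℕ) : t k + j ≤ t (k + j) := by
  induction j with
  | zero => simp
  | succ j ih =>
    have := t_lt_t_succ (k + j)
    show t k + (j + 1) ≤ t (k + j + 1)
    omega

/-- the terms `(1/10)^(t j)` -/
def term (j : ℕ) : ℝ := (1 / 10 : ℝ) ^ t j

/-- The terms are positive. -/
theorem term_pos (j : ℕ) : 0 < term j := by unfold term; positivity

/-- The terms are dominated by the geometric series `(1/10)^(j+1)`. -/
theorem term_le_geom (j : ℕ) : term j ≤ (1 / 10 : ℝ) * (1 / 10 : ℝ) ^ j := by
  unfold term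
  rw [← pow_succ']
  exact pow_le_pow_of_le_one (by norm_num) (by norm_num) (succ_le_t j)

/-- Summability of the dominating geometric series. -/
theorem summable_geom : Summable (fun j : ℕ => (1 / 10 : ℝ) * (1 / 10 : ℝ) ^ j) :=
  (summable_geometric_of_lt_one (by norm_num) (by norm_num)).mul_left _

/-- The series defining `r` is summable. -/
theorem summable_term : Summable term :=
  Summable.of_nonneg_of_le (fun j => (term_pos j).le) term_le_geom summable_geom

/-- the ultra-Liouville number `r = ∑ (1/10)^(t j)` -/
def r : ℝ := ∑' j, term j

/-- partial sums -/
def rpart (k : ℕ) : ℝ := ∑ j ∈ Finset.range (k + 1), term j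

/-- numerators `p k = ∑_{j ≤ k} 10^(t k − t j)` -/
def pnum (k : ℕ) : ℕ := ∑ j ∈ Finset.range (k + 1), 10 ^ (t k - t j)

/-- The `k`-th partial sum is the rational `pnum k / 10^(t k)`. -/
theorem rpart_eq (k : ℕ) : rpart k = (pnum k : ℝ) / (10 : ℝ) ^ t k := by
  unfold rpart pnum term
  push_cast
  rw [Finset.sum_div]
  refine Finset.sum_congr rfl fun j hj => ?_
  have hj' : t j ≤ t k := t_mono (by simpa [Nat.lt_succ_iff] using hj)
  rw [one_div_pow, eq_div_iff (by positivity), one_div, inv_mul_eq_iff_eq_mul₀ (by positivity),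
    ← pow_add, Nat.add_sub_cancel' hj']

/-- `1 ≤ pnum k`. -/
theorem one_le_pnum (k : ℕ) : 1 ≤ pnum k := by
  unfold pnum
  calc 1 = 10 ^ (t k - t k) := by simp
    _ ≤ ∑ j ∈ Finset.range (k + 1), 10 ^ (t k - t j) :=
      Finset.single_le_sum (f := fun j => 10 ^ (t k - t j)) (fun _ _ => Nat.zero_le _)
        (Finset.self_mem_range_succ k)

/-- Summability of the tails. -/
theorem tail_summable (k : ℕ) : Summable (fun j => term (j + (k + 1))) :=
  (summable_nat_add_iff (k + 1)).mpr summable_term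

/-- `r − rpart k` is the `k`-th tail. -/
theorem tail_eq (k : ℕ) : r - rpart k = ∑' j, term (j + (k + 1)) := by
  unfold r rpart
  rw [← Summable.sum_add_tsum_nat_add (k + 1) summable_term]
  ring

/-- The tails are positive (so `r ≠ rpart k`). -/
theorem tail_pos (k : ℕ) : 0 < r - rpart k := by
  rw [tail_eq]
  exact (tail_summable k).tsum_pos (fun j => (term_pos _).le) 0 (term_pos _)

/-- TAIL BOUND: `r − rpart k ≤ 2 · 10^(−t (k+1))` — hyper-fast convergence relative to the denominator `10^(t k)`. -/
theorem tail_le (k : ℕ) : r - rpart k ≤ 2 * (1 / 10 : ℝ) ^ t (k + 1) := by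
  rw [tail_eq]
  have hle : ∀ j, term (j + (k + 1)) ≤ (1 / 10 : ℝ) ^ t (k + 1) * (1 / 10 : ℝ) ^ j := by
    intro j
    unfold term
    rw [← pow_add]
    apply pow_le_pow_of_le_one (by norm_num) (by norm_num)
    have := t_add_le (k + 1) j
    rw [add_comm j]; exact this
  have hsg : Summable (fun j : ℕ => (1 / 10 : ℝ) ^ t (k + 1) * (1 / 10 : ℝ) ^ j) :=
    (summable_geometric_of_lt_one (by norm_num) (by norm_num)).mul_left _
  calc ∑' j, term (j + (k + 1)) ≤ ∑' j, (1 / 10 : ℝ) ^ t (k + 1) * (1 / 10 : ℝ) ^ j :=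
        (tail_summable k).tsum_le_tsum hle hsg
    _ = (1 / 10 : ℝ) ^ t (k + 1) * (1 - 1 / 10)⁻¹ := by
        rw [tsum_mul_left, tsum_geometric_of_lt_one (by norm_num) (by norm_num)]
    _ ≤ 2 * (1 / 10 : ℝ) ^ t (k + 1) := by
        rw [mul_comm]; gcongr; norm_num

/-- `r ≤ 1/9`. -/
theorem r_le : r ≤ 1 / 9 := by
  unfold r
  calc ∑' j, term j ≤ ∑' j, (1 / 10 : ℝ) * (1 / 10 : ℝ) ^ j :=
        summable_term.tsum_le_tsum term_le_geom summable_geom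
    _ = (1 / 10 : ℝ) * (1 - 1 / 10)⁻¹ := by
        rw [tsum_mul_left, tsum_geometric_of_lt_one (by norm_num) (by norm_num)]
    _ = 1 / 9 := by norm_num

/-- The partial sums are positive. -/
theorem rpart_pos (k : ℕ) : 0 < rpart k :=
  Finset.sum_pos (fun j _ => term_pos j) ⟨0, by simp⟩

/-- `0 < r`. -/
theorem r_pos : 0 < r := by
  have := tail_pos 0; have := rpart_pos 0; linarith

/-- `rpart k < r`. -/
theorem rpart_lt_r (k : ℕ) : rpart k < r := by have := tail_pos k; linarith

/-- `pnum k < 10^(t k)`, i.e. `rpart k < 1`. -/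
theorem pnum_lt (k : ℕ) : pnum k < 10 ^ t k := by
  have h : (pnum k : ℝ) / (10 : ℝ) ^ t k < 1 := by
    rw [← rpart_eq]; have := rpart_lt_r k; have := r_le; linarith
  rw [div_lt_one (by positivity)] at h
  exact_mod_cast h

/-- `r` is a Liouville number (denominators `10^(t n)`, errors `≤ 2·10^(−t(n+1)) < 10^(−n·t n)`). -/
theorem liouville_r : Liouville r := by
  intro n
  have hq : (((10 ^ t n : ℕ) : ℤ) : ℝ) = (10 : ℝ) ^ t n := by push_cast; ring
  have hp : ((pnum n : ℤ) : ℝ) = (pnum n : ℝ) := by push_cast; ring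
  have hpq : ((pnum n : ℤ) : ℝ) / (((10 ^ t n : ℕ) : ℤ) : ℝ) = rpart n := by
    rw [hp, hq, ← rpart_eq]
  refine ⟨(pnum n : ℤ), ((10 ^ t n : ℕ) : ℤ), ?_, ?_, ?_⟩
  · have : 10 ≤ 10 ^ t n := by
      calc 10 = 10 ^ 1 := by norm_num
        _ ≤ 10 ^ t n := Nat.pow_le_pow_right (by norm_num) (one_le_t n)
    exact_mod_cast (show 1 < 10 ^ t n by omega)
  · rw [hpq]; exact (rpart_lt_r n).ne'
  · rw [hpq, abs_of_pos (tail_pos n)]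
    have hexp : n * t n + 2 ≤ t (n + 1) := by
      have h1 := lt_t_succ n
      have h2 : n * t n + t n ≤ (n + 1) ^ 2 * t n := by
        have : n + 1 ≤ (n + 1) ^ 2 := Nat.le_self_pow (by norm_num) _
        calc n * t n + t n = (n + 1) * t n := by ring
          _ ≤ (n + 1) ^ 2 * t n := Nat.mul_le_mul_right _ this
      have h3 := one_le_t n
      omega
    have hX : (0 : ℝ) < ((10 : ℝ) ^ (n * t n))⁻¹ := by positivity
    calc r - rpart n ≤ 2 * (1 / 10 : ℝ) ^ t (n + 1) := tail_le n
      _ ≤ 2 * (1 / 10 : ℝ) ^ (n * t n + 2) :=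
          mul_le_mul_of_nonneg_left (pow_le_pow_of_le_one (by norm_num) (by norm_num) hexp)
            (by norm_num)
      _ < 1 / (((10 ^ t n : ℕ) : ℤ) : ℝ) ^ n := by
          rw [hq, ← pow_mul, pow_add, one_div_pow, mul_comm (t n) n]
          norm_num
          linarith

/-- `r` is irrational. -/
theorem irrational_r : Irrational r := liouville_r.irrational


end Summit.Schanuel.Schanuel.Cruxes.KhovanskiiApproxType.Negative.Tower

end
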